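import Summits.ValiantsHypothesis.ValiantsHypothesis.Theorems.PolyaContinuedMonotoneCoverHardGradedLowerBound

/-!
# Crux `MonotoneCoverHard` (stmt-ValiantsHypothesis-7421): the layer cut of a LEVELLED cover has at most
`m^(c_h + c_{h-1})` states — the crux reduces to a bound on LEVEL WIDTHS

WIDTH REFORMULATION of line `few_state_cut` (val-width-7421-p2 g0, 2026-08-27).  Every label-bijective
cover `(m, E, a)` of `per_n` carries a LEVEL FUNCTION `g : Fin m ⊕ Fin m → ℕ` on its used edges
(`g(col) = g(row) + [label is a variable]`): the alternating variable-count vanishes on every alternating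
cycle (each weight-nonzero perfect matching has exactly `n` variable edges) and alternating cycles span
the cycle space of a matching-covered bipartite graph (Lovász–Plummer: the perfect matchings of an
elementary bipartite graph span a space of dimension `|E| - |V| + 2`).  With respect to `g`, the number
`c_ℓ` of variable edges of a weight-nonzero perfect matching whose row endpoint has level `ℓ` is the
SAME for all matchings (`c_ℓ - c_{ℓ-1} = |R_ℓ| - |C_ℓ|` by counting the two ways level-`ℓ` vertices
are covered) — the LEVEL PROFILE of the cover; graded covers (`…GradedCut.lean`) are the case
`c_ℓ = 1`.  (These two structural facts are recorded in `Cruxes/MonotoneCoverHard/CALIBRATION-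
few_state_cut.md`; they are not needed as hypotheses below because the theorems quantify the level
function and consume only what they use.)

This file generalises the graded layer-cut theorem to arbitrary width, for the concrete coefficient
ring `ℂ` and variables `Fin n × Fin n` of the registered stubs:

* `crossing_eq_of_sets_eq` — KEY LEMMA at width `> 1`: the crossing set of the layer cut `S_h` of a
  weight-nonzero perfect matching `τ` is determined by the pair of SETS (rows of its level-`h` variable
  edges, columns of its level-`(h-1)` variable edges), by the same recombination argument;
* `exists_balanced_cut_card_le_pow_of_width` — if level `h` is balanced (`n ≤ 3 k_h ≤ 2n` for the
  common below-`h` variable count) and the widths at levels `h`, `h - 1` are `c_h`, `c_{h-1}`, the layer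
  cut is balanced with at most `m^(c_h + c_{h-1})` crossing states;
* `two_pow_le_pow_width` — RUNG: with val-width-7421-p1's `stub_rectangleBound`,
  `2^(n/3) ≤ m^(c_h + c_{h-1})` for every label-bijective Pfaffian cover and every balanced level `h`.

Consequently the crux `MonotoneCoverHard` FOLLOWS from the purely structural WIDTH BET: "every label-
bijective Pfaffian cover of `per_n` has a balanced level `h` with `c_h + c_{h-1} ≤ polylog m`" (then
`polylog(m) · log₂ m ≥ n/3`).  A level of width `w` means `w` variable edges of EVERY matching run in
parallel between the same two vertex layers; keeping parallel "tokens" coherent without a `K_{3,3}`-type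
coupling is what Pfaffian graphs seem unable to do — that is the open content, not addressed here.
VP ≠ VNP is not moved.  No definitions.
-/

namespace Summit.ValiantsHypothesis.ValiantsHypothesis.Theorems.PolyaContinuedMonotoneCoverHard

-- summit = sub-problem name (single-conjunct summit, D-0017 layout), so the namespace repeats it
set_option linter.dupNamespace false

open scoped Classical
open Finset
open Summit.ValiantsHypothesis.ValiantsHypothesis.Theorems.PolyaContinued.MonotoneCoverHardRectangle
  (stub_rectangleBound)

/-- KEY LEMMA at arbitrary width.  In a levelled cover in which weight-nonzero perfect matchings are
determined by their variable edges, the set of non-variable edges with row endpoint on level `h`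
(`1 ≤ h`) of a weight-nonzero perfect matching `τ` is determined by the SET of rows of its level-`h`
variable edges together with the SET of columns of its level-`(h-1)` variable edges. -/
theorem crossing_eq_of_sets_eq {m n : ℕ} (E : Finset (Fin m × Fin m))
    (a : Fin m × Fin m → MvPolynomial (Fin n × Fin n) ℂ) (g : Fin m ⊕ Fin m → ℕ) (h : ℕ) (h1 : 1 ≤ h)
    (hvar : ∀ i j, (i, j) ∈ E → (∃ k, a (i, j) = MvPolynomial.X k) →
      g (Sum.inr j) = g (Sum.inl i) + 1)
    (hone : ∀ i j, (i, j) ∈ E → a (i, j) ≠ 0 → (¬ ∃ k, a (i, j) = MvPolynomial.X k) →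
      g (Sum.inr j) = g (Sum.inl i))
    (hinj : ∀ τ τ' : Equiv.Perm (Fin m), (∀ i, (i, τ i) ∈ E ∧ a (i, τ i) ≠ 0) →
      (∀ i, (i, τ' i) ∈ E ∧ a (i, τ' i) ≠ 0) →
      (∀ i, ((∃ k, a (i, τ i) = MvPolynomial.X k) ∨ (∃ k, a (i, τ' i) = MvPolynomial.X k)) →
        τ i = τ' i) → τ = τ')
    (τ τ' : Equiv.Perm (Fin m)) (hτ : ∀ i, (i, τ i) ∈ E ∧ a (i, τ i) ≠ 0)
    (hτ' : ∀ i, (i, τ' i) ∈ E ∧ a (i, τ' i) ≠ 0)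
    (hK1 : (univ.filter fun i : Fin m => (∃ k, a (i, τ i) = MvPolynomial.X k) ∧ g (Sum.inl i) = h) =
      univ.filter fun i : Fin m => (∃ k, a (i, τ' i) = MvPolynomial.X k) ∧ g (Sum.inl i) = h)
    (hK2 : ((univ.filter fun i : Fin m =>
        (∃ k, a (i, τ i) = MvPolynomial.X k) ∧ g (Sum.inl i) = h - 1).image τ) =
      (univ.filter fun i : Fin m =>
        (∃ k, a (i, τ' i) = MvPolynomial.X k) ∧ g (Sum.inl i) = h - 1).image τ') :
    ((univ.filter fun i : Fin m =>
        (¬ ∃ j, a (i, τ i) = MvPolynomial.X j) ∧ g (Sum.inl i) = h).image fun i => (i, τ i)) =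
      (univ.filter fun i : Fin m =>
        (¬ ∃ j, a (i, τ' i) = MvPolynomial.X j) ∧ g (Sum.inl i) = h).image fun i => (i, τ' i) := by
  -- transport of the two keys: level-`h` variable rows, and columns hit from level `h - 1`
  have eqV : ∀ i, ((∃ k, a (i, τ i) = MvPolynomial.X k) ∧ g (Sum.inl i) = h) ↔
      ((∃ k, a (i, τ' i) = MvPolynomial.X k) ∧ g (Sum.inl i) = h) := by
    intro i
    have h' := congrArg (fun s : Finset (Fin m) => i ∈ s) hK1
    simpa using h'
  have eqH : ∀ c, (∃ i, ((∃ k, a (i, τ i) = MvPolynomial.X k) ∧ g (Sum.inl i) = h - 1) ∧ τ i = c) ↔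
      (∃ i, ((∃ k, a (i, τ' i) = MvPolynomial.X k) ∧ g (Sum.inl i) = h - 1) ∧ τ' i = c) := by
    intro c
    have h' := congrArg (fun s : Finset (Fin m) => c ∈ s) hK2
    simpa using h'
  -- (A) for a weight-nonzero `σ`: a level-`h` row with a non-variable edge goes to a level-`h`
  --     column that is not hit from level `h - 1`
  have hA : ∀ σ : Equiv.Perm (Fin m), (∀ i, (i, σ i) ∈ E ∧ a (i, σ i) ≠ 0) →
      ∀ i, g (Sum.inl i) = h → (¬ ∃ k, a (i, σ i) = MvPolynomial.X k) →
        g (Sum.inr (σ i)) = h ∧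
          ¬ ∃ i', ((∃ k, a (i', σ i') = MvPolynomial.X k) ∧ g (Sum.inl i') = h - 1) ∧ σ i' = σ i := by
    intro σ hσ i hi hnv
    refine ⟨(hone i (σ i) (hσ i).1 (hσ i).2 hnv).trans hi, ?_⟩
    rintro ⟨i', ⟨-, hi'⟩, heq⟩
    have : i' = i := σ.injective heq
    rw [this] at hi'
    omega
  -- (B) conversely such a column is entered from a level-`h` row by a non-variable edge
  have hB : ∀ σ : Equiv.Perm (Fin m), (∀ i, (i, σ i) ∈ E ∧ a (i, σ i) ≠ 0) →
      ∀ i, g (Sum.inr (σ i)) = h →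
        (¬ ∃ i', ((∃ k, a (i', σ i') = MvPolynomial.X k) ∧ g (Sum.inl i') = h - 1) ∧ σ i' = σ i) →
        g (Sum.inl i) = h ∧ ¬ ∃ k, a (i, σ i) = MvPolynomial.X k := by
    intro σ hσ i hi hnh
    by_cases hv : ∃ k, a (i, σ i) = MvPolynomial.X k
    · have := hvar i (σ i) (hσ i).1 hv
      exact absurd ⟨i, ⟨hv, by omega⟩, rfl⟩ hnh
    · have := hone i (σ i) (hσ i).1 (hσ i).2 hv
      exact ⟨by omega, hv⟩
  -- the recombined matching: `τ'` on the level-`h` rows with non-variable edge, `τ` elsewhere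
  set A : Finset (Fin m) := univ.filter fun i : Fin m =>
    g (Sum.inl i) = h ∧ ¬ ∃ k, a (i, τ i) = MvPolynomial.X k with hAdef
  have hmemA : ∀ i, i ∈ A ↔ g (Sum.inl i) = h ∧ ¬ ∃ k, a (i, τ i) = MvPolynomial.X k :=
    fun i => by simp [hAdef]
  have hmemA' : ∀ i, i ∈ A ↔ g (Sum.inl i) = h ∧ ¬ ∃ k, a (i, τ' i) = MvPolynomial.X k := by
    intro i
    rw [hmemA]
    constructor
    · rintro ⟨hi, hnv⟩
      exact ⟨hi, fun hv => hnv ((eqV i).2 ⟨hv, hi⟩).1⟩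
    · rintro ⟨hi, hnv⟩
      exact ⟨hi, fun hv => hnv ((eqV i).1 ⟨hv, hi⟩).1⟩
  set f : Fin m → Fin m := fun i => if i ∈ A then τ' i else τ i with hf
  have hfA : ∀ i, i ∈ A → f i = τ' i := fun i hi => if_pos hi
  have hfnA : ∀ i, i ∉ A → f i = τ i := fun i hi => if_neg hi
  have hmix : ∀ i i', i ∈ A → i' ∉ A → τ' i ≠ τ i' := by
    intro i i' hi hi' heq
    have hiA := (hmemA' i).1 hi
    obtain ⟨h2, h3⟩ := hA τ' hτ' i hiA.1 hiA.2
    rw [heq] at h2 h3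
    have h3' : ¬ ∃ j, ((∃ k, a (j, τ j) = MvPolynomial.X k) ∧ g (Sum.inl j) = h - 1) ∧ τ j = τ i' :=
      fun hh => h3 ((eqH (τ i')).1 hh)
    exact hi' ((hmemA i').2 (hB τ hτ i' h2 h3'))
  have hfinj : Function.Injective f := by
    intro i i' hii'
    by_cases hi : i ∈ A <;> by_cases hi' : i' ∈ A
    · rw [hfA i hi, hfA i' hi'] at hii'
      exact τ'.injective hii'
    · rw [hfA i hi, hfnA i' hi'] at hii'
      exact absurd hii' (hmix i i' hi hi')
    · rw [hfnA i hi, hfA i' hi'] at hii'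
      exact absurd hii'.symm (hmix i' i hi' hi)
    · rw [hfnA i hi, hfnA i' hi'] at hii'
      exact τ.injective hii'
  set σ : Equiv.Perm (Fin m) := Equiv.ofBijective f
    ⟨hfinj, Finite.surjective_of_injective hfinj⟩ with hσdef
  have hσf : ∀ i, σ i = f i := fun i => rfl
  have hσ : ∀ i, (i, σ i) ∈ E ∧ a (i, σ i) ≠ 0 := by
    intro i
    rw [hσf]
    by_cases hi : i ∈ A
    · rw [hfA i hi]; exact hτ' i
    · rw [hfnA i hi]; exact hτ i
  have hτσ : τ = σ := by
    refine hinj τ σ hτ hσ fun i hi => ?_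
    rw [hσf]
    by_cases hiA : i ∈ A
    · exfalso
      rcases hi with hi | hi
      · exact ((hmemA i).1 hiA).2 hi
      · rw [hσf, hfA i hiA] at hi
        exact ((hmemA' i).1 hiA).2 hi
    · exact (hfnA i hiA).symm
  have hagree : ∀ i ∈ A, τ i = τ' i := by
    intro i hiA
    have : τ i = σ i := by rw [hτσ]
    rw [this, hσf, hfA i hiA]
  -- both crossing filters are `A`
  have hfτ : (univ.filter fun i : Fin m =>
      (¬ ∃ j, a (i, τ i) = MvPolynomial.X j) ∧ g (Sum.inl i) = h) = A := by
    ext i; rw [hmemA]; simp only [mem_filter, mem_univ, true_and]; exact and_comm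
  have hfτ' : (univ.filter fun i : Fin m =>
      (¬ ∃ j, a (i, τ' i) = MvPolynomial.X j) ∧ g (Sum.inl i) = h) = A := by
    ext i; rw [hmemA']; simp only [mem_filter, mem_univ, true_and]; exact and_comm
  rw [hfτ, hfτ']
  exact Finset.image_congr fun i hi => by simp [hagree i (mem_coe.1 hi)]

/-- **Layer cut of a levelled cover: balanced, with at most `m^(c_h + c_{h-1})` states.**  Let
`(E, a)` be a cover on `m + m` vertices with level function `g` (`hvar`, `hone`) whose weight-nonzero
perfect matchings are determined by their variable edges (`hinj`).  Suppose the cut level `h ≥ 1` is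
BALANCED — every weight-nonzero perfect matching has between `n/3` and `2n/3` variable edges with row
endpoint below level `h` (`hwin`; by the level-profile invariance this count does not depend on the
matching) — and the widths at levels `h` and `h - 1` are `c_h` and `c_{h-1}` (`hch`, `hcq`).  Then the
layer cut `S_h = {rows of level < h} ∪ {columns of level ≤ h}` is balanced and has at most
`m^(c_h + c_{h-1})` crossing states. -/
theorem exists_balanced_cut_card_le_pow_of_width {m : ℕ} (n : ℕ) (E : Finset (Fin m × Fin m))
    (a : Fin m × Fin m → MvPolynomial (Fin n × Fin n) ℂ) (g : Fin m ⊕ Fin m → ℕ) (h ch cq : ℕ)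
    (h1 : 1 ≤ h)
    (hvar : ∀ i j, (i, j) ∈ E → (∃ k, a (i, j) = MvPolynomial.X k) →
      g (Sum.inr j) = g (Sum.inl i) + 1)
    (hone : ∀ i j, (i, j) ∈ E → a (i, j) ≠ 0 → (¬ ∃ k, a (i, j) = MvPolynomial.X k) →
      g (Sum.inr j) = g (Sum.inl i))
    (hwin : ∀ τ : Equiv.Perm (Fin m), (∀ i, (i, τ i) ∈ E ∧ a (i, τ i) ≠ 0) →
      n ≤ 3 * (univ.filter fun i : Fin m =>
          (∃ k, a (i, τ i) = MvPolynomial.X k) ∧ g (Sum.inl i) < h).card ∧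
        3 * (univ.filter fun i : Fin m =>
          (∃ k, a (i, τ i) = MvPolynomial.X k) ∧ g (Sum.inl i) < h).card ≤ 2 * n)
    (hch : ∀ τ : Equiv.Perm (Fin m), (∀ i, (i, τ i) ∈ E ∧ a (i, τ i) ≠ 0) →
      (univ.filter fun i : Fin m =>
        (∃ k, a (i, τ i) = MvPolynomial.X k) ∧ g (Sum.inl i) = h).card = ch)
    (hcq : ∀ τ : Equiv.Perm (Fin m), (∀ i, (i, τ i) ∈ E ∧ a (i, τ i) ≠ 0) →
      (univ.filter fun i : Fin m =>
        (∃ k, a (i, τ i) = MvPolynomial.X k) ∧ g (Sum.inl i) = h - 1).card = cq)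
    (hinj : ∀ τ τ' : Equiv.Perm (Fin m), (∀ i, (i, τ i) ∈ E ∧ a (i, τ i) ≠ 0) →
      (∀ i, (i, τ' i) ∈ E ∧ a (i, τ' i) ≠ 0) →
      (∀ i, ((∃ k, a (i, τ i) = MvPolynomial.X k) ∨ (∃ k, a (i, τ' i) = MvPolynomial.X k)) →
        τ i = τ' i) → τ = τ') :
    ∃ S : Finset (Fin m ⊕ Fin m),
      (∀ τ : Equiv.Perm (Fin m), (∀ i, (i, τ i) ∈ E ∧ a (i, τ i) ≠ 0) →
        n ≤ 3 * (univ.filter fun i : Fin m =>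
            Sum.inl i ∈ S ∧ Sum.inr (τ i) ∈ S ∧ ∃ j, a (i, τ i) = MvPolynomial.X j).card ∧
        3 * (univ.filter fun i : Fin m =>
            Sum.inl i ∈ S ∧ Sum.inr (τ i) ∈ S ∧ ∃ j, a (i, τ i) = MvPolynomial.X j).card ≤ 2 * n) ∧
      ((univ.filter fun τ : Equiv.Perm (Fin m) => ∀ i, (i, τ i) ∈ E ∧ a (i, τ i) ≠ 0).image
          (fun τ : Equiv.Perm (Fin m) => (univ.filter fun i : Fin m =>
            (Sum.inl i ∈ S ∧ Sum.inr (τ i) ∉ S) ∨ (Sum.inl i ∉ S ∧ Sum.inr (τ i) ∈ S)).image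
              fun i => (i, τ i))).card ≤ m ^ (ch + cq) := by
  set S : Finset (Fin m ⊕ Fin m) := univ.filter fun x =>
    Sum.elim (fun i => g (Sum.inl i) < h) (fun j => g (Sum.inr j) ≤ h) x with hSdef
  have hSl : ∀ i, Sum.inl i ∈ S ↔ g (Sum.inl i) < h := fun i => by simp [hSdef]
  have hSr : ∀ j, Sum.inr j ∈ S ↔ g (Sum.inr j) ≤ h := fun j => by simp [hSdef]
  -- bookkeeping (as in `…GradedCut.lean`, restated for the concrete instances of this file)
  have hinside : ∀ τ : Equiv.Perm (Fin m), (∀ i, (i, τ i) ∈ E ∧ a (i, τ i) ≠ 0) →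
      (univ.filter fun i : Fin m =>
          Sum.inl i ∈ S ∧ Sum.inr (τ i) ∈ S ∧ ∃ j, a (i, τ i) = MvPolynomial.X j) =
        univ.filter fun i : Fin m => (∃ j, a (i, τ i) = MvPolynomial.X j) ∧ g (Sum.inl i) < h := by
    intro τ hτ
    ext i
    simp only [mem_filter, mem_univ, true_and, hSl, hSr]
    constructor
    · rintro ⟨h1', -, h3⟩
      exact ⟨h3, h1'⟩
    · rintro ⟨h3, h1'⟩
      have := hvar i (τ i) (hτ i).1 h3
      exact ⟨h1', by omega, h3⟩
  have hcross : ∀ τ : Equiv.Perm (Fin m), (∀ i, (i, τ i) ∈ E ∧ a (i, τ i) ≠ 0) →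
      (univ.filter fun i : Fin m =>
          (Sum.inl i ∈ S ∧ Sum.inr (τ i) ∉ S) ∨ (Sum.inl i ∉ S ∧ Sum.inr (τ i) ∈ S)) =
        univ.filter fun i : Fin m =>
          (¬ ∃ j, a (i, τ i) = MvPolynomial.X j) ∧ g (Sum.inl i) = h := by
    intro τ hτ
    ext i
    simp only [mem_filter, mem_univ, true_and, hSl, hSr]
    by_cases hv : ∃ j, a (i, τ i) = MvPolynomial.X j
    · have := hvar i (τ i) (hτ i).1 hv
      constructor
      · intro h'; omega
      · rintro ⟨h', -⟩; exact absurd hv h'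
    · have := hone i (τ i) (hτ i).1 (hτ i).2 hv
      constructor
      · intro h'; exact ⟨hv, by omega⟩
      · rintro ⟨-, h'⟩; omega
  refine ⟨S, fun τ hτ => by rw [hinside τ hτ]; exact hwin τ hτ, ?_⟩
  set good := univ.filter fun τ : Equiv.Perm (Fin m) => ∀ i, (i, τ i) ∈ E ∧ a (i, τ i) ≠ 0
    with hgood
  have hmem : ∀ τ, τ ∈ good ↔ ∀ i, (i, τ i) ∈ E ∧ a (i, τ i) ≠ 0 := fun τ => by simp [hgood]
  set K : Equiv.Perm (Fin m) → Finset (Fin m) × Finset (Fin m) := fun τ =>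
    ((univ.filter fun i : Fin m => (∃ k, a (i, τ i) = MvPolynomial.X k) ∧ g (Sum.inl i) = h),
      (univ.filter fun i : Fin m =>
        (∃ k, a (i, τ i) = MvPolynomial.X k) ∧ g (Sum.inl i) = h - 1).image τ) with hKdef
  set t : Finset (Finset (Fin m) × Finset (Fin m)) :=
    (powersetCard ch (univ : Finset (Fin m))) ×ˢ (powersetCard cq (univ : Finset (Fin m))) with htdef
  have ht : t.card ≤ m ^ (ch + cq) := by
    rw [htdef, card_product, card_powersetCard, card_powersetCard, card_univ, Fintype.card_fin,
      pow_add]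
    exact Nat.mul_le_mul (Nat.choose_le_pow _ _) (Nat.choose_le_pow _ _)
  have hKt : ∀ τ ∈ good, K τ ∈ t := by
    intro τ hτ
    rw [hmem] at hτ
    simp only [hKdef, htdef, mem_product, mem_powersetCard, subset_univ, true_and]
    refine ⟨hch τ hτ, ?_⟩
    rw [card_image_of_injective _ τ.injective]
    exact hcq τ hτ
  refine (card_image_le_of_factor good t K
    (fun τ : Equiv.Perm (Fin m) => (univ.filter fun i : Fin m =>
      (Sum.inl i ∈ S ∧ Sum.inr (τ i) ∉ S) ∨ (Sum.inl i ∉ S ∧ Sum.inr (τ i) ∈ S)).image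
        fun i => (i, τ i)) hKt ?_).trans ht
  intro τ hτ τ' hτ' hK
  rw [hmem] at hτ hτ'
  rw [hcross τ hτ, hcross τ' hτ']
  exact crossing_eq_of_sets_eq E a g h h1 hvar hone hinj τ τ' hτ hτ'
    (congrArg Prod.fst hK) (congrArg Prod.snd hK)

/-- **RUNG (width form): `2^(n/3) ≤ m^(c_h + c_{h-1})`.**  For every label-bijective Pfaffian cover of
`per_n` on `m + m` vertices, every level function `g` and every balanced level `h ≥ 1` whose widths are
`c_h`, `c_{h-1}`: the rectangle bound of val-width-7421-p1 (`stub_rectangleBound`) applied to the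
layer cut of `exists_balanced_cut_card_le_pow_of_width` (label-injectivity from `eq_of_agree_on_var`).
Hence a quasi-polynomial cover forces width `c_h + c_{h-1} ≥ n / polylog n` at every balanced level:
the crux `MonotoneCoverHard` reduces to a polylogarithmic WIDTH bound for Pfaffian covers. -/
theorem two_pow_le_pow_width (n m : ℕ) (E : Finset (Fin m × Fin m))
    (a : Fin m × Fin m → MvPolynomial (Fin n × Fin n) ℂ)
    (hsig : ∃ s : Fin m × Fin m → ℂ, (∀ e, s e = 1 ∨ s e = -1) ∧
      (Matrix.of fun i j => if (i, j) ∈ E then MvPolynomial.C (s (i, j)) * MvPolynomial.X (i, j)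
          else 0 : Matrix (Fin m) (Fin m) (MvPolynomial (Fin m × Fin m) ℂ)).det =
        (Matrix.of fun i j => if (i, j) ∈ E then MvPolynomial.X (i, j) else 0 :
          Matrix (Fin m) (Fin m) (MvPolynomial (Fin m × Fin m) ℂ)).permanent)
    (ha : ∀ e, (∃ j, a e = MvPolynomial.X j) ∨ a e = 0 ∨ a e = 1)
    (hper : Literature.Computability.AlgebraicComplexity.perPoly (Fin n) ℂ =
      MvPolynomial.aeval a (Matrix.of fun i j => if (i, j) ∈ E then MvPolynomial.X (i, j) else 0 :
          Matrix (Fin m) (Fin m) (MvPolynomial (Fin m × Fin m) ℂ)).permanent)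
    (g : Fin m ⊕ Fin m → ℕ) (h ch cq : ℕ) (h1 : 1 ≤ h)
    (hvar : ∀ i j, (i, j) ∈ E → (∃ k, a (i, j) = MvPolynomial.X k) →
      g (Sum.inr j) = g (Sum.inl i) + 1)
    (hone : ∀ i j, (i, j) ∈ E → a (i, j) ≠ 0 → (¬ ∃ k, a (i, j) = MvPolynomial.X k) →
      g (Sum.inr j) = g (Sum.inl i))
    (hwin : ∀ τ : Equiv.Perm (Fin m), (∀ i, (i, τ i) ∈ E ∧ a (i, τ i) ≠ 0) →
      n ≤ 3 * (univ.filter fun i : Fin m =>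
          (∃ k, a (i, τ i) = MvPolynomial.X k) ∧ g (Sum.inl i) < h).card ∧
        3 * (univ.filter fun i : Fin m =>
          (∃ k, a (i, τ i) = MvPolynomial.X k) ∧ g (Sum.inl i) < h).card ≤ 2 * n)
    (hch : ∀ τ : Equiv.Perm (Fin m), (∀ i, (i, τ i) ∈ E ∧ a (i, τ i) ≠ 0) →
      (univ.filter fun i : Fin m =>
        (∃ k, a (i, τ i) = MvPolynomial.X k) ∧ g (Sum.inl i) = h).card = ch)
    (hcq : ∀ τ : Equiv.Perm (Fin m), (∀ i, (i, τ i) ∈ E ∧ a (i, τ i) ≠ 0) →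
      (univ.filter fun i : Fin m =>
        (∃ k, a (i, τ i) = MvPolynomial.X k) ∧ g (Sum.inl i) = h - 1).card = cq) :
    2 ^ (n / 3) ≤ m ^ (ch + cq) := by
  obtain ⟨S, hbal, hcard⟩ := exists_balanced_cut_card_le_pow_of_width n E a g h ch cq h1 hvar hone
    hwin hch hcq (fun τ τ' hτ hτ' hh => eq_of_agree_on_var E a ha hper τ τ' hτ hτ' hh)
  exact (stub_rectangleBound n m E a hsig ha hper S hbal).trans hcard

end Summit.ValiantsHypothesis.ValiantsHypothesis.Theorems.PolyaContinuedMonotoneCoverHard
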